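import Literature.MathematicalPhysics.QuantumFieldTheory.Balaban1983to89.B5Eq190FlatCoercivityUniform

/-!
# `Balaban1983to89.B5Eq190FlatCoercivitySpacingUniform` — T. Bałaban, *Propagators and renormalization transformations for lattice gauge theories. I*,
# Commun. Math. Phys. **95** (1984) 17–40 [Balaban1984PropagatorsI] Prop. 1.1 (1.90) p. 33 with (1.69) p. 29, and *Regularity and decay of lattice
# Green's functions*, Commun. Math. Phys. **89** (1983) 571–597 [Balaban1983RegularityDecay] (2.27) p. 580, FOR *Propagators for lattice gauge theories in
# a background field*, Commun. Math. Phys. **99** (1985) 389–434 [Balaban1985BackgroundPropagators] (3.26) p. 395 ∕ Thm 3.11 p. 416 AT THE FLAT BACKGROUND: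
# THE COERCIVITY CONSTANT OF THE pub-balaban NE9 CHAIN'S FLAT PRINCIPAL GAUGE-FIXED OPERATOR `D*D + D R(1) D* + aQ(1)†Q(1)` IS `γ(d,1)·min(a″,1)∕(ηL)²`
# — LINEAR IN THE AVERAGING WEIGHT AT SMALL `a″` — HENCE ONE CONSTANT SERVES EVERY SPACING `0 < η ≤ 1∕L` AND EVERY VOLUME, AND ALONG THE CANONICAL
# WEIGHTS (`c₁(ηL)² = c₀L^d`, blocks of side `ηL ≤ 1`) IT IS `γ(d,1)·min(a,1)`, FREE OF `m, L, η, c₀, c₁`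

statement-level skeleton of published theorems with citation tags; proofs where landed; nothing here is a claim about the Yang–Mills mass gap

PDF held: `paper:balaban1984-cmp95-propagators-rt-i` p. 33 (= p0017 of the text layer) and `paper:balaban1983-cmp89-regularity-decay` p. 580 (= p0010), both
opened by this seat (2026-08-22); `paper:balaban1985-cmp99-background-propagators` pp. 393–395, 416 via the tree's (F) ∕ `B9Eq315QTorus` ∕ `B9Thm311SmallFieldCoercivity` docstrings.

THE PRINT (verbatim, text layers open in this session).  [B5] p. 33 (p0017 L5–9): *«Proposition 1.1. The operator G is a symmetric operator on L²(T_η) and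
‖GJ‖, ‖∇GJ‖, ‖G∇*J‖, ‖∇G∇*J‖, ‖∇∇GJ‖, ‖G∇*∇*J‖ ≤ γ₀⁻¹‖J‖, (1.89) with a positive constant γ₀ independent of k, T_η, and depending on d only (if we put
a = 1). This implies the bound from below: Δ_a = G⁻¹ ≥ γ₀(Δ + I). (1.90)»*.  [B4] p. 580 (p0010 L21–25): *«The operator −Δ^{η,N}_Δ is bounded from below
by π² on a subspace of functions on Δ orthogonal to constant functions, which are its eigenvectors corresponding to eigenvalue 0. The operator P_k is an
orthogonal projection on a subspace of constant functions, thus ⟨φ, (−Δ^{η,N}_Δ + a_kP_k)φ⟩ ≥ min{π², a_k}‖φ‖²_{L²(Δ)} (2.27)»*.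

WHY THIS FILE (cell context).  The NE9 leaf `ne9-leaf-03` (gen 59) made the flat constant of [B9] Thm 3.11's chain VOLUME-FREE (`B5Eq190FlatCoercivityUniform.
flat_coercive_uniform`: `(γ(d,a″)∕(ηL)²)·‖x‖² ≤ re⟨x, Δ_{1,a}(1)x⟩`, `a″ = a·c₁·(ηL)²∕(c₀L^d)`, `γ(d,a) = 1∕((d+1)·Cst d a)` — b05's kernel-certified (1.90)
transported).  The NE9 OWNER (gen 82, journal census) then recorded: *«η-uniform flat coercivity through (F) NOT attempted — b05's `Cst d a″` … behaves like
a″⁻³ at small a″ …, so γ(d,a″)∕(ηL)² → 0 as η → 0 — an η-free constant needs `Cst ≤ C(d)∕a`»*.  THIS FILE removes the obstruction without touching b05: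
by (F)'s three squares ((1.69): `re⟨x, Δ_{1,a}(1)x⟩ = ‖D(1)x‖² + ‖R(1)D*(1)x‖² + a‖Q(1)x‖²`) the flat form is MONOTONE AND SUB-LINEAR in the averaging
weight — `min(a∕a₀, 1)·re⟨x, Δ_{1,a₀}(1)x⟩ ≤ re⟨x, Δ_{1,a}(1)x⟩` (cf. the `min{π², a_k}` shape of (2.27) and Prop. 1.1's «if we put a = 1») — so (F)
read at the ONE value `a₀` with `a₀″ = 1` gives b05's constant AT `a = 1` times `min(a″, 1)`: the small-`a″` behaviour is now LINEAR (the true order: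
the block-constant mode has form `a‖Q(1)x‖²`), and along `η → 0` at fixed `(L, a, c₀, c₁)` the constant no longer degenerates.

WHAT IS PROVED (sorry-free; 0 `def`; [folklore] order arithmetic on top of the tree's (F); no inequality of the papers asserted).
* §1 `min_mul_form_le` (`min(a∕a₀,1)·(P + a₀S) ≤ P + aS` for `P, S ≥ 0` — cf. (2.27)'s `min` shape), private `min_scale_le` (`min(s,1) ≤ min(s·t,1)·t⁻¹`, `0 < t ≤ 1`).
* §2 **`min_mul_re_inner_flat_le`** — the flat form of the chain is sub-linear∕monotone in `a`:
  `min(a∕a₀,1)·re⟨x, Δ_{1,a₀}(1)x⟩ ≤ re⟨x, Δ_{1,a}(1)x⟩` (any fibre reading `φ`, any flat letters); `re_inner_flat_mono` (`a₀ ≤ a`).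
* §3 **`flat_coercive_uniform_linear`**: `(γ(d,1)·min(a″,1)∕(ηL)²)·‖x‖² ≤ re⟨x, Δ_{1,a}(1)x⟩`, `a″ = a·c₁·(ηL)²∕(c₀L^d)` — (F) at `a₀ := c₀L^d∕(c₁(ηL)²)`
  (`a₀″ = 1`) and §2; `linearConst_pos`.
* §4 **`flat_coercive_spacing_uniform`**: for `0 < η`, `η·L ≤ 1`: `(γ(d,1)·min(a·c₁∕(c₀L^d), 1))·‖x‖² ≤ re⟨x, Δ_{1,a}(1)x⟩` — NO `η` in the constant;
  **`exists_coercive_principal_flat_spacing_uniform`**: at fixed `(d, L, a, c₀, c₁)` (and fibre) ONE `γ > 0` for EVERY spacing `0 < η ≤ 1∕L` and every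
  volume `m` — `∃ γ` BEFORE `∀ η ∀ m` (the OWNER's declined census item).
* §5 **`flat_coercive_canonical`** (print's weight relation `c₁·(ηL)² = c₀·L^d` — (3.16)'s `(L^jη)^{d−2}` against `η^d`; at `ηL = 1`: `c₁ = c₀L^d` —
  and `0 < ηL ≤ 1` ⇒ `a″ = a` and constant `γ(d,1)·min(a,1)`), **`exists_coercive_principal_flat_canonical`**: ONE `γ > 0` BEFORE `∀ L ∀ η ∀ c₀ c₁ ∀ m`
  along Bałaban's normalisation — print's «independent of k, T_η, and depending on d only».
* §6 **`coercive_principal_of_near_flat_spacing_uniform`** — the near-flat shape of (F) §last ∕ `B5Eq172FlatCoercivity` (the one (C2′) consumes) with the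
  new constant: `‖(Δ_prin(U) − Δ_prin(1))x‖ ≤ δ‖x‖ ⇒ (γ(d,1)·min(a″,1)∕(ηL)² − δ)‖x‖² ≤ re⟨x, Δ_prin(U)x⟩`; **`coercive_principal_of_near_flat_eta_free`** —
  the same with §4's η-free constant for `0 < η ≤ 1∕L`.
MODEL ∕ DECLARED READINGS.  (M1) exactly (F)'s: one averaging step on `TSite d (L·m)`, fine weight `c₀`, coarse weight `c₁`, scalar `η⁻¹`; the constants
are b05's `Cst d 1` (explicit, huge — reader arithmetic at `d = 4`: `Cst 4 1 ≈ 2·10¹⁷`; no optimality claimed) times displayed scalings.  (M2) no hypothesis of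
the papers displayed; `η ≠ 0` (resp. `0 < η ≤ 1∕L`), `0 < a`, `1 ≤ L`; §5's weight relation and block-side window are the DISPLAYED normalisation (the cell's junction note in `B9Eq315QTorus`: (3.26)'s `aQ*Q` is print's
(3.16) iff `c₁ = (Lη)^{d−2}`), not a claim about the chain's instantiation.  (M3) NOT HERE: print's multi-level operators (3.16)∕(3.24) (`Σ_j a Σ_{Λ_j} (L^jη)^{d−2}|Q_jA|²`, levels `j < k`), (1.89)'s decay and derivative bounds, [B9] Thm 3.3,
backgrounds `U ≠ 1` beyond the near-flat shape, the small-field step (the OWNER's (C2)∕(E) and ne9-leaf-03's (C2′)∕(E′) re-plugged with this constant — not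
done here), the gauge step of p. 416.
HONEST SCOPE.  A one-line monotonicity ([folklore]) composed BY NAME with the tree's (F); an explicit constant with the right small-`a` order replaces one that
degenerates; nothing of [B9] Thm 3.11 at `U ≠ 1` is asserted; «NE9 ⇐ the named binders»; NOT summit progress (cell pub-balaban: NE9 NOT PRINTED ∕ NOT PROVED;
spine PROVED 0∕9; rung (B)+1 finite T⁴ — NOT infinite volume, NOT mass gap, NOT Clay; HONEST DEPENDENCY: continuum YM on T⁴ ⇐ BetaPertH ∧ nine spine
estimates (0/9 proved); BetaPertH ⇐ (D1) ∧ (D4) ∧ CAP+tail; G-an2-4 gates asym, D1 and NE2/3/4).  Unit `b2b-balaban-t4-ne9-formalise-leaf-04` (NE9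
crux-team leaf prover, gen 72), INTENT I-ne9leaf04-g72-1; NEW file importing `B5Eq190FlatCoercivityUniform` only; modifies nothing.  Net new unproved facts: 0.
-/

noncomputable section

open scoped BigOperators InnerProductSpace ComplexConjugate

namespace Literature.MathematicalPhysics.QuantumFieldTheory.Balaban1983to89.B5Eq190FlatCoercivitySpacingUniform

open B4Sect5Torus (TSite)
open B9SectCLatticeCarrier (Bond)
open B11Eq103H1Complex (BondL2K covDivL2K laplaceALatticeK)
open B9Eq310HessianOperator (adTransportW principalOpK covCurlL2K)
open B7Prop1Explicit (U1 Wcx boxVec)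
open B9Eq319QprimeTorus (fineP)
open B9Eq326OperatorAssembly (RofU)
open B9Eq315QTorus (perCfg cornerSite QtorusW)
open B5Eq172FlatCoercivity (hU1_one hreg_one)
open B5Eq172HodgePositivity (coercive_of_sub_le)
open B5Eq190FlatCoercivityUniform (re_inner_flat_eq_three_sq flat_coercive_uniform)

variable {d : ℕ}

/-! ## §1 The scalar device ([folklore] order arithmetic) -/

/-- For `P, S ≥ 0`, `0 < a₀` and any real `a`: `min(a∕a₀, 1)·(P + a₀·S) ≤ P + a·S` — a form `P + aS` with a non-negative `a`-free part is sub-linear∕monotone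
in `a` ([folklore] scalar arithmetic; cf. print's `min{π², a_k}` in (2.27), obtained there from the orthogonal eigenvalue split Laplacian ⊥ constants —
the analogy is the `min{·, a}` shape only). [cite: Balaban1983RegularityDecay, (2.27) p.580] -/
theorem min_mul_form_le {P S a a₀ : ℝ} (hP : 0 ≤ P) (hS : 0 ≤ S) (ha₀ : 0 < a₀) :
    min (a / a₀) 1 * (P + a₀ * S) ≤ P + a * S := by
  rcases le_total (a / a₀) 1 with h | h
  · rw [min_eq_left h]
    have h1 : a / a₀ * P ≤ P := by nlinarith [mul_nonneg (show 0 ≤ 1 - a / a₀ by linarith) hP]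
    have h2 : a / a₀ * (a₀ * S) = a * S := by field_simp
    calc a / a₀ * (P + a₀ * S) = a / a₀ * P + a / a₀ * (a₀ * S) := by ring
      _ ≤ P + a * S := by rw [h2]; linarith
  · rw [min_eq_right h, one_mul]
    have ha₀a : a₀ ≤ a := by rwa [le_div_iff₀ ha₀, one_mul] at h
    have : a₀ * S ≤ a * S := mul_le_mul_of_nonneg_right ha₀a hS
    linarith

/-- For `0 < t ≤ 1` (any real `s`): `min(s, 1) ≤ min(s·t, 1)·t⁻¹` — the scaling step of §4 (`t = (ηL)²`). [folklore] -/
private theorem min_scale_le {s t : ℝ} (ht : 0 < t) (ht1 : t ≤ 1) : min s 1 ≤ min (s * t) 1 * t⁻¹ := by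
  rcases le_total (s * t) 1 with h | h
  · rw [min_eq_left h, mul_assoc, mul_inv_cancel₀ ht.ne', mul_one]
    exact min_le_left _ _
  · rw [min_eq_right h, one_mul]
    have h1 : (1 : ℝ) ≤ t⁻¹ := one_le_inv_iff₀.mpr ⟨ht, ht1⟩
    exact (min_le_right _ _).trans h1

/-! ## §2 The chain's flat principal gauge-fixed form is sub-linear∕monotone in the averaging weight `a` -/

section Mono

variable (L : ℕ) [NeZero L] (m : Fin d → ℕ) [∀ i, NeZero (fineP L m i)] (hL : 1 ≤ L) {c₀ c₁ : ℝ} [Fact (0 < c₀)] [Fact (0 < c₁)]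
  {𝔸 : Type*} [NormedRing 𝔸] [NormedAlgebra ℂ 𝔸] [CompleteSpace 𝔸] [NormOneClass 𝔸]
  {W : Type*} [NormedAddCommGroup W] [InnerProductSpace ℂ W] [FiniteDimensional ℂ W] (φ : W ≃ₗ[ℂ] 𝔸)
  {α : ℝ} (hα1 : α ≤ 1 / 64)
  (hU1 : ∀ (x : B7Prop1Explicit.Site d) (κ : Fin d), perCfg (fineP L m) (fun _ : Bond d (fineP L m) => (1 : 𝔸ˣ)) x κ ∈ U1 𝔸)
  (hreg : ∀ (y : TSite d m) (κ : Fin d) (r : Fin d → Fin L),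
    ‖((Wcx L (perCfg (fineP L m) (fun _ : Bond d (fineP L m) => (1 : 𝔸ˣ))) (cornerSite L y) κ (boxVec L r) : 𝔸ˣ) : 𝔸) - 1‖ ≤ α)
  (η : ℝ)

/-- **THE FLAT FORM IS SUB-LINEAR ∕ MONOTONE IN `a`**: for `0 < a₀`, any real `a` and every `W`-valued bond function `x`,
`min(a∕a₀, 1)·re⟨x, (D*D + D R(1) D* + a₀Q(1)†Q(1)) x⟩ ≤ re⟨x, (D*D + D R(1) D* + aQ(1)†Q(1)) x⟩` — by the three squares of (1.69)
(`B5Eq190FlatCoercivityUniform.re_inner_flat_eq_three_sq`: the `a`-free part `‖D(1)x‖² + ‖R(1)D*(1)x‖²` is non-negative, the averaging square enters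
with the factor `a`).  [cite: Balaban1984PropagatorsI, (1.69) p.29; Balaban1983RegularityDecay, (2.27) p.580] -/
theorem min_mul_re_inner_flat_le {a a₀ : ℝ} (ha₀ : 0 < a₀) (x : BondL2K ℂ d (fineP L m) c₀ W) :
    min (a / a₀) 1 * RCLike.re ⟪x, laplaceALatticeK ((η : ℂ))⁻¹ (adTransportW φ (fun _ : Bond d (fineP L m) => (1 : 𝔸ˣ)))
        (adTransportW φ fun _ : Bond d (fineP L m) => (1 : 𝔸ˣ)⁻¹) (principalOpK φ η fun _ => 1) (RofU L m φ η fun _ => 1)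
        (QtorusW L m hL φ (fun _ => 1) hα1 hU1 hreg (c₁ := c₁)) a₀ x⟫_ℂ ≤
      RCLike.re ⟪x, laplaceALatticeK ((η : ℂ))⁻¹ (adTransportW φ (fun _ : Bond d (fineP L m) => (1 : 𝔸ˣ)))
        (adTransportW φ fun _ : Bond d (fineP L m) => (1 : 𝔸ˣ)⁻¹) (principalOpK φ η fun _ => 1) (RofU L m φ η fun _ => 1)
        (QtorusW L m hL φ (fun _ => 1) hα1 hU1 hreg (c₁ := c₁)) a x⟫_ℂ := by
  rw [re_inner_flat_eq_three_sq L m hL φ hα1 hU1 hreg η a₀ x, re_inner_flat_eq_three_sq L m hL φ hα1 hU1 hreg η a x]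
  exact min_mul_form_le (add_nonneg (sq_nonneg _) (sq_nonneg _)) (sq_nonneg _) ha₀

/-- **… IN PARTICULAR MONOTONE**: `a₀ ≤ a ⇒ re⟨x, Δ_{1,a₀}(1)x⟩ ≤ re⟨x, Δ_{1,a}(1)x⟩`. [cite: Balaban1984PropagatorsI, (1.69) p.29] -/
theorem re_inner_flat_mono {a a₀ : ℝ} (ha₀ : 0 < a₀) (hle : a₀ ≤ a) (x : BondL2K ℂ d (fineP L m) c₀ W) :
    RCLike.re ⟪x, laplaceALatticeK ((η : ℂ))⁻¹ (adTransportW φ (fun _ : Bond d (fineP L m) => (1 : 𝔸ˣ)))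
        (adTransportW φ fun _ : Bond d (fineP L m) => (1 : 𝔸ˣ)⁻¹) (principalOpK φ η fun _ => 1) (RofU L m φ η fun _ => 1)
        (QtorusW L m hL φ (fun _ => 1) hα1 hU1 hreg (c₁ := c₁)) a₀ x⟫_ℂ ≤
      RCLike.re ⟪x, laplaceALatticeK ((η : ℂ))⁻¹ (adTransportW φ (fun _ : Bond d (fineP L m) => (1 : 𝔸ˣ)))
        (adTransportW φ fun _ : Bond d (fineP L m) => (1 : 𝔸ˣ)⁻¹) (principalOpK φ η fun _ => 1) (RofU L m φ η fun _ => 1)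
        (QtorusW L m hL φ (fun _ => 1) hα1 hU1 hreg (c₁ := c₁)) a x⟫_ℂ := by
  have h := min_mul_re_inner_flat_le L m hL φ (c₁ := c₁) hα1 hU1 hreg η (a := a) ha₀ x
  have h1 : min (a / a₀) 1 = 1 := min_eq_right (by rw [le_div_iff₀ ha₀, one_mul]; exact hle)
  rwa [h1, one_mul] at h

end Mono

/-! ## §3 (1.90) for the chain with the constant LINEAR in `a″` at small `a″`: b05's `Cst` evaluated at `a = 1` only -/

section Linear

variable (L : ℕ) [NeZero L] (m : Fin d → ℕ) [∀ i, NeZero (fineP L m i)] (hL : 1 ≤ L) {c₀ c₁ : ℝ} [Fact (0 < c₀)] [Fact (0 < c₁)]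
  {𝔸 : Type*} [NormedRing 𝔸] [NormedAlgebra ℂ 𝔸] [CompleteSpace 𝔸] [NormOneClass 𝔸]
  {W : Type*} [NormedAddCommGroup W] [InnerProductSpace ℂ W] [FiniteDimensional ℂ W] (φ : W ≃ₗ[ℂ] 𝔸)
  {α : ℝ} (hα1 : α ≤ 1 / 64)
  (hU1 : ∀ (x : B7Prop1Explicit.Site d) (κ : Fin d), perCfg (fineP L m) (fun _ : Bond d (fineP L m) => (1 : 𝔸ˣ)) x κ ∈ U1 𝔸)
  (hreg : ∀ (y : TSite d m) (κ : Fin d) (r : Fin d → Fin L),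
    ‖((Wcx L (perCfg (fineP L m) (fun _ : Bond d (fineP L m) => (1 : 𝔸ˣ))) (cornerSite L y) κ (boxVec L r) : 𝔸ˣ) : 𝔸) - 1‖ ≤ α)
  {η : ℝ} (hη : η ≠ 0) {a : ℝ} (ha : 0 < a)

include hη ha

/-- **[B5] PROP. 1.1 (1.90) FOR THE NE9 CHAIN's FLAT PRINCIPAL GAUGE-FIXED OPERATOR, CONSTANT LINEAR IN THE AVERAGING WEIGHT**: for every
finite-dimensional Hilbert fibre `W`, every algebra reading `φ`, every flat regularity letter, every volume `m` and every `W`-valued bond function `x`: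
`(γ(d,1)·min(a″,1)∕(ηL)²)·‖x‖² ≤ re⟨x, (D*D + D R(1) D* + aQ(1)†Q(1)) x⟩`, `a″ = a·c₁·(ηL)²∕(c₀·L^d)`, `γ(d,1) = 1∕((d+1)·B5Prop11Plancherel.Cst d 1)` —
`B5Eq190FlatCoercivityUniform.flat_coercive_uniform` READ AT THE ONE WEIGHT `a₀ := c₀L^d∕(c₁(ηL)²)` (the value with `a₀″ = 1`: print's «if we put a = 1»)
and the sub-linearity §2 (`a∕a₀ = a″`).  The constant depends on `d, L, η, a, c₀, c₁` only and is of the TRUE ORDER `a″` as `a″ → 0` (b05's `Cst d a″`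
behaves like `a″⁻³` there). [cite: Balaban1984PropagatorsI, Prop. 1.1 (1.90) p.33, (1.69) p.29; Balaban1983RegularityDecay, (2.27) p.580; Balaban1985BackgroundPropagators, (3.26) p.395, Thm 3.11 p.416] -/
theorem flat_coercive_uniform_linear (x : BondL2K ℂ d (fineP L m) c₀ W) :
    (1 / ((d + 1 : ℝ) * B5Prop11Plancherel.Cst d 1)) * min (a * c₁ * (η * L) ^ 2 / (c₀ * (L : ℝ) ^ d)) 1 * ((η * L)⁻¹) ^ 2 * ‖x‖ ^ 2 ≤
      RCLike.re ⟪x, laplaceALatticeK ((η : ℂ))⁻¹ (adTransportW φ (fun _ : Bond d (fineP L m) => (1 : 𝔸ˣ)))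
        (adTransportW φ fun _ : Bond d (fineP L m) => (1 : 𝔸ˣ)⁻¹) (principalOpK φ η fun _ => 1) (RofU L m φ η fun _ => 1)
        (QtorusW L m hL φ (fun _ => 1) hα1 hU1 hreg (c₁ := c₁)) a x⟫_ℂ := by
  have hc₀ : 0 < c₀ := Fact.out; have hc₁ : 0 < c₁ := Fact.out
  have hLr : (0 : ℝ) < L := by exact_mod_cast Nat.pos_of_ne_zero (NeZero.ne L)
  -- the one weight at which b05's constant is read: `a₀″ = 1`
  have ha₀ : 0 < c₀ * (L : ℝ) ^ d / (c₁ * (η * L) ^ 2) := by positivity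
  have hF := flat_coercive_uniform L m hL φ (c₁ := c₁) hα1 hU1 hreg hη ha₀ x
  have h1 : c₀ * (L : ℝ) ^ d / (c₁ * (η * L) ^ 2) * c₁ * (η * L) ^ 2 / (c₀ * (L : ℝ) ^ d) = 1 := by
    field_simp
  rw [h1] at hF
  -- sub-linearity between `a₀` and `a`; `a ∕ a₀ = a″`
  have h2 : a / (c₀ * (L : ℝ) ^ d / (c₁ * (η * L) ^ 2)) = a * c₁ * (η * L) ^ 2 / (c₀ * (L : ℝ) ^ d) := by
    field_simp
  have hmono := min_mul_re_inner_flat_le L m hL φ (c₁ := c₁) hα1 hU1 hreg η (a := a) ha₀ x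
  rw [h2] at hmono
  have hmin0 : 0 ≤ min (a * c₁ * (η * L) ^ 2 / (c₀ * (L : ℝ) ^ d)) 1 := le_min (by positivity) zero_le_one
  calc 1 / ((d + 1 : ℝ) * B5Prop11Plancherel.Cst d 1) * min (a * c₁ * (η * L) ^ 2 / (c₀ * (L : ℝ) ^ d)) 1 * ((η * L)⁻¹) ^ 2 * ‖x‖ ^ 2
      = min (a * c₁ * (η * L) ^ 2 / (c₀ * (L : ℝ) ^ d)) 1 *
          (1 / ((d + 1 : ℝ) * B5Prop11Plancherel.Cst d 1) * ((η * L)⁻¹) ^ 2 * ‖x‖ ^ 2) := by ring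
    _ ≤ _ := mul_le_mul_of_nonneg_left hF hmin0
    _ ≤ _ := hmono

omit [Fact (0 < c₀)] [Fact (0 < c₁)] hη in
/-- The linear constant is positive (`0 < c₀, c₁`, `η ≠ 0`, `0 < a`). [cite: Balaban1984PropagatorsI, Prop. 1.1 (1.90) p.33] -/
theorem linearConst_pos (hc₀ : 0 < c₀) (hc₁ : 0 < c₁) (hη' : η ≠ 0) :
    0 < (1 / ((d + 1 : ℝ) * B5Prop11Plancherel.Cst d 1)) * min (a * c₁ * (η * L) ^ 2 / (c₀ * (L : ℝ) ^ d)) 1 * ((η * L)⁻¹) ^ 2 := by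
  have hC : (1 : ℝ) ≤ B5Prop11Plancherel.Cst d 1 := B5Prop11Lower.one_le_Cst _
  have hLr : (0 : ℝ) < L := by exact_mod_cast Nat.pos_of_ne_zero (NeZero.ne L)
  have hmin : 0 < min (a * c₁ * (η * L) ^ 2 / (c₀ * (L : ℝ) ^ d)) 1 := lt_min (by positivity) one_pos
  positivity

/-! ## §4 Uniformity in the SPACING: one constant for every `0 < η ≤ 1∕L` (and every volume) at fixed `(d, L, a, c₀, c₁)` -/

omit hη in
/-- **THE FLAT COERCIVITY CONSTANT DOES NOT DEGENERATE AS `η → 0`**: for `0 < η` with `η·L ≤ 1` (blocks of side at most one),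
`(γ(d,1)·min(a·c₁∕(c₀L^d), 1))·‖x‖² ≤ re⟨x, (D*D + D R(1) D* + aQ(1)†Q(1)) x⟩` — NO `η` (and no `m`) in the constant: with `t = (ηL)² ∈ ]0,1]`,
`min(s·t,1)∕t ≥ min(s,1)` for `s = a·c₁∕(c₀L^d)` (§3 + `min_scale_le`).  This is the OWNER's declined census item («an η-free constant»), obtained
from the linear order in `a″` instead of a sharper b05 constant. [cite: Balaban1984PropagatorsI, Prop. 1.1 (1.90) p.33; Balaban1983RegularityDecay, (2.27) p.580; Balaban1985BackgroundPropagators, Thm 3.11 p.416] -/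
theorem flat_coercive_spacing_uniform (hη0 : 0 < η) (hηL1 : η * L ≤ 1) (x : BondL2K ℂ d (fineP L m) c₀ W) :
    (1 / ((d + 1 : ℝ) * B5Prop11Plancherel.Cst d 1)) * min (a * c₁ / (c₀ * (L : ℝ) ^ d)) 1 * ‖x‖ ^ 2 ≤
      RCLike.re ⟪x, laplaceALatticeK ((η : ℂ))⁻¹ (adTransportW φ (fun _ : Bond d (fineP L m) => (1 : 𝔸ˣ)))
        (adTransportW φ fun _ : Bond d (fineP L m) => (1 : 𝔸ˣ)⁻¹) (principalOpK φ η fun _ => 1) (RofU L m φ η fun _ => 1)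
        (QtorusW L m hL φ (fun _ => 1) hα1 hU1 hreg (c₁ := c₁)) a x⟫_ℂ := by
  have hc₀ : 0 < c₀ := Fact.out; have hc₁ : 0 < c₁ := Fact.out
  have hLr : (0 : ℝ) < L := by exact_mod_cast Nat.pos_of_ne_zero (NeZero.ne L)
  have hηL0 : 0 < η * L := by positivity
  have ht : 0 < (η * L) ^ 2 := by positivity
  have ht1 : (η * L) ^ 2 ≤ 1 := by nlinarith
  have hlin := flat_coercive_uniform_linear L m hL φ (c₁ := c₁) hα1 hU1 hreg hη0.ne' ha x
  have hscale := min_scale_le (s := a * c₁ / (c₀ * (L : ℝ) ^ d)) ht ht1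
  have hprod : a * c₁ / (c₀ * (L : ℝ) ^ d) * (η * L) ^ 2 = a * c₁ * (η * L) ^ 2 / (c₀ * (L : ℝ) ^ d) := by ring
  have hinv : ((η * L) ^ 2)⁻¹ = ((η * L)⁻¹) ^ 2 := by rw [inv_pow]
  rw [hprod, hinv] at hscale
  have hC : (1 : ℝ) ≤ B5Prop11Plancherel.Cst d 1 := B5Prop11Lower.one_le_Cst _
  have hγ : 0 ≤ 1 / ((d + 1 : ℝ) * B5Prop11Plancherel.Cst d 1) := by positivity
  calc 1 / ((d + 1 : ℝ) * B5Prop11Plancherel.Cst d 1) * min (a * c₁ / (c₀ * (L : ℝ) ^ d)) 1 * ‖x‖ ^ 2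
      ≤ 1 / ((d + 1 : ℝ) * B5Prop11Plancherel.Cst d 1) *
          (min (a * c₁ * (η * L) ^ 2 / (c₀ * (L : ℝ) ^ d)) 1 * ((η * L)⁻¹) ^ 2) * ‖x‖ ^ 2 :=
        mul_le_mul_of_nonneg_right (mul_le_mul_of_nonneg_left hscale hγ) (sq_nonneg _)
    _ = 1 / ((d + 1 : ℝ) * B5Prop11Plancherel.Cst d 1) * min (a * c₁ * (η * L) ^ 2 / (c₀ * (L : ℝ) ^ d)) 1 * ((η * L)⁻¹) ^ 2 *
          ‖x‖ ^ 2 := by ring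
    _ ≤ _ := hlin

end Linear

section SpacingExists

variable (L : ℕ) [NeZero L] (hL : 1 ≤ L) {c₀ c₁ : ℝ} [Fact (0 < c₀)] [Fact (0 < c₁)]
  {𝔸 : Type*} [NormedRing 𝔸] [NormedAlgebra ℂ 𝔸] [CompleteSpace 𝔸] [NormOneClass 𝔸]
  {W : Type*} [NormedAddCommGroup W] [InnerProductSpace ℂ W] [FiniteDimensional ℂ W] (φ : W ≃ₗ[ℂ] 𝔸)
  {a : ℝ} (ha : 0 < a)

include ha

/-- **`∃ γ` BEFORE `∀ η ∀ m`**: at fixed `(d, L, a, c₀, c₁)` (and fibre reading) ONE `γ = γ(d,1)·min(a·c₁∕(c₀L^d), 1) > 0` is a coercivity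
constant of the chain's flat principal gauge-fixed operator `(D*D + D R(1) D* + aQ(1)†Q(1))` (flat letters supplied, `α := 0`) for EVERY spacing
`0 < η ≤ 1∕L` and EVERY volume `m` — `B5Eq190FlatCoercivityUniform.exists_coercive_principal_flat_uniform` with the spacing ALSO quantified inside.
[cite: Balaban1984PropagatorsI, Prop. 1.1 (1.90) p.33 («γ₀ independent of k, T_η»); Balaban1983RegularityDecay, (2.27) p.580; Balaban1985BackgroundPropagators, Thm 3.11 p.416] -/
theorem exists_coercive_principal_flat_spacing_uniform :
    ∃ γ : ℝ, 0 < γ ∧ ∀ (η : ℝ), 0 < η → η * L ≤ 1 → ∀ (m : Fin d → ℕ) [∀ i, NeZero (fineP L m i)] (x : BondL2K ℂ d (fineP L m) c₀ W),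
      γ * ‖x‖ ^ 2 ≤
        RCLike.re ⟪x, laplaceALatticeK ((η : ℂ))⁻¹ (adTransportW φ (fun _ : Bond d (fineP L m) => (1 : 𝔸ˣ)))
          (adTransportW φ fun _ : Bond d (fineP L m) => (1 : 𝔸ˣ)⁻¹) (principalOpK φ η fun _ => 1) (RofU L m φ η fun _ => 1)
          (QtorusW L m hL φ (fun _ => 1) (show (0 : ℝ) ≤ 1 / 64 by norm_num) (hU1_one L m) (hreg_one L m) (c₁ := c₁)) a x⟫_ℂ := by
  have hc₀ : 0 < c₀ := Fact.out
  have hc₁ : 0 < c₁ := Fact.out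
  have hLr : (0 : ℝ) < L := by exact_mod_cast Nat.pos_of_ne_zero (NeZero.ne L)
  have hC : (1 : ℝ) ≤ B5Prop11Plancherel.Cst d 1 := B5Prop11Lower.one_le_Cst _
  refine ⟨(1 / ((d + 1 : ℝ) * B5Prop11Plancherel.Cst d 1)) * min (a * c₁ / (c₀ * (L : ℝ) ^ d)) 1, ?_, fun η hη0 hηL1 m _ x => ?_⟩
  · have hmin : 0 < min (a * c₁ / (c₀ * (L : ℝ) ^ d)) 1 := lt_min (by positivity) one_pos
    positivity
  · exact flat_coercive_spacing_uniform L m hL φ (c₁ := c₁) _ (hU1_one L m) (hreg_one L m) ha hη0 hηL1 x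

end SpacingExists

/-! ## §5 The canonical normalisation: unit blocks `ηL = 1`, weights `c₁ = c₀·L^d` — one constant `γ(d,1)·min(a,1)` for everything -/

section Canonical

variable (L : ℕ) [NeZero L] (m : Fin d → ℕ) [∀ i, NeZero (fineP L m i)] (hL : 1 ≤ L) {c₀ c₁ : ℝ} [Fact (0 < c₀)] [Fact (0 < c₁)]
  {𝔸 : Type*} [NormedRing 𝔸] [NormedAlgebra ℂ 𝔸] [CompleteSpace 𝔸] [NormOneClass 𝔸]
  {W : Type*} [NormedAddCommGroup W] [InnerProductSpace ℂ W] [FiniteDimensional ℂ W] (φ : W ≃ₗ[ℂ] 𝔸)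
  {α : ℝ} (hα1 : α ≤ 1 / 64)
  (hU1 : ∀ (x : B7Prop1Explicit.Site d) (κ : Fin d), perCfg (fineP L m) (fun _ : Bond d (fineP L m) => (1 : 𝔸ˣ)) x κ ∈ U1 𝔸)
  (hreg : ∀ (y : TSite d m) (κ : Fin d) (r : Fin d → Fin L),
    ‖((Wcx L (perCfg (fineP L m) (fun _ : Bond d (fineP L m) => (1 : 𝔸ˣ))) (cornerSite L y) κ (boxVec L r) : 𝔸ˣ) : 𝔸) - 1‖ ≤ α)
  {η : ℝ} {a : ℝ} (ha : 0 < a)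

include ha

/-- **ALONG BAŁABAN's NORMALISATION THE CONSTANT IS `γ(d,1)·min(a,1)`**: if the coarse and fine weights are related as in print's (3.16)
«⟨A, Q*aQA⟩ = Σ_j a Σ_{b∈Λ_j} (L^jη)^{d−2}|(Q_j(U)A)(b)|²» (`c₁·(ηL)² = c₀·L^d` — e.g. `c₀ = η^d`, `c₁ = (ηL)^{d−2}`; at unit blocks `ηL = 1` this is
`c₁ = c₀·L^d`), then `a″ = a` IDENTICALLY and, for blocks of side `0 < ηL ≤ 1`, `(γ(d,1)·min(a,1))·‖x‖² ≤ re⟨x, (D*D + D R(1) D* + aQ(1)†Q(1)) x⟩`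
— free of `m, L, η, c₀, c₁` (print: «independent of k, T_η, and depending on d only (if we put a = 1)»; the discarded factor `(ηL)⁻² ≥ 1` is the
block-side rescaling of (F)'s dictionary). [cite: Balaban1984PropagatorsI, Prop. 1.1 (1.90) p.33; Balaban1983RegularityDecay, (2.27) p.580; Balaban1985BackgroundPropagators, (3.16) p.393, (3.26) p.395, Thm 3.11 p.416] -/
theorem flat_coercive_canonical (hηL0 : 0 < η * L) (hηL1 : η * L ≤ 1) (hs : c₁ * (η * L) ^ 2 = c₀ * (L : ℝ) ^ d)
    (x : BondL2K ℂ d (fineP L m) c₀ W) :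
    (1 / ((d + 1 : ℝ) * B5Prop11Plancherel.Cst d 1)) * min a 1 * ‖x‖ ^ 2 ≤
      RCLike.re ⟪x, laplaceALatticeK ((η : ℂ))⁻¹ (adTransportW φ (fun _ : Bond d (fineP L m) => (1 : 𝔸ˣ)))
        (adTransportW φ fun _ : Bond d (fineP L m) => (1 : 𝔸ˣ)⁻¹) (principalOpK φ η fun _ => 1) (RofU L m φ η fun _ => 1)
        (QtorusW L m hL φ (fun _ => 1) hα1 hU1 hreg (c₁ := c₁)) a x⟫_ℂ := by
  have hc₀ : 0 < c₀ := Fact.out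
  have hLr : (0 : ℝ) < L := by exact_mod_cast Nat.pos_of_ne_zero (NeZero.ne L)
  have hη : η ≠ 0 := by rintro rfl; rw [zero_mul] at hηL0; exact lt_irrefl _ hηL0
  have hlin := flat_coercive_uniform_linear L m hL φ (c₁ := c₁) hα1 hU1 hreg hη ha x
  -- `a″ = a` under the weight relation
  have hden : c₀ * (L : ℝ) ^ d ≠ 0 := by positivity
  have h1 : a * c₁ * (η * L) ^ 2 / (c₀ * (L : ℝ) ^ d) = a := by
    rw [mul_assoc, hs, mul_div_assoc, div_self hden, mul_one]
  rw [h1] at hlin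
  -- the block-side factor `(ηL)⁻² ≥ 1`
  have hinv : (1 : ℝ) ≤ ((η * L)⁻¹) ^ 2 := by
    have h1le : (1 : ℝ) ≤ (η * L)⁻¹ := one_le_inv_iff₀.mpr ⟨hηL0, hηL1⟩
    nlinarith
  have hC : (1 : ℝ) ≤ B5Prop11Plancherel.Cst d 1 := B5Prop11Lower.one_le_Cst _
  have hγ : 0 ≤ 1 / ((d + 1 : ℝ) * B5Prop11Plancherel.Cst d 1) * min a 1 := mul_nonneg (by positivity) (le_min ha.le zero_le_one)
  calc 1 / ((d + 1 : ℝ) * B5Prop11Plancherel.Cst d 1) * min a 1 * ‖x‖ ^ 2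
      ≤ 1 / ((d + 1 : ℝ) * B5Prop11Plancherel.Cst d 1) * min a 1 * ((η * L)⁻¹) ^ 2 * ‖x‖ ^ 2 :=
        mul_le_mul_of_nonneg_right (le_mul_of_one_le_right hγ hinv) (sq_nonneg _)
    _ ≤ _ := hlin

end Canonical

section CanonicalExists

variable {𝔸 : Type*} [NormedRing 𝔸] [NormedAlgebra ℂ 𝔸] [CompleteSpace 𝔸] [NormOneClass 𝔸]
  {W : Type*} [NormedAddCommGroup W] [InnerProductSpace ℂ W] [FiniteDimensional ℂ W] (φ : W ≃ₗ[ℂ] 𝔸)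
  {a : ℝ} (ha : 0 < a)

include ha

/-- **`∃ γ` BEFORE `∀ L ∀ η ∀ c₀ c₁ ∀ m`** — print's «independent of k, T_η, and depending on d only»: ONE `γ = γ(d,1)·min(a,1) > 0` is a coercivity
constant of the chain's flat principal gauge-fixed operator for EVERY block size `L ≥ 1`, every spacing with blocks of side `0 < ηL ≤ 1`, every pair
of weights in print's relation `c₁·(ηL)² = c₀·L^d` ((3.16)'s `(L^jη)^{d−2}` against `η^d`; at `ηL = 1`: `c₁ = c₀·L^d`), every volume `m` and every
bond function (flat letters supplied, `α := 0`). [cite: Balaban1984PropagatorsI, Prop. 1.1 (1.90) p.33; Balaban1983RegularityDecay, (2.27) p.580; Balaban1985BackgroundPropagators, (3.16) p.393, (3.26) p.395, Thm 3.11 p.416] -/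
theorem exists_coercive_principal_flat_canonical :
    ∃ γ : ℝ, 0 < γ ∧ ∀ (L : ℕ) [NeZero L] (hL : 1 ≤ L) (η : ℝ), 0 < η * L → η * L ≤ 1 →
      ∀ (c₀ c₁ : ℝ) [Fact (0 < c₀)] [Fact (0 < c₁)], c₁ * (η * L) ^ 2 = c₀ * (L : ℝ) ^ d →
      ∀ (m : Fin d → ℕ) [∀ i, NeZero (fineP L m i)] (x : BondL2K ℂ d (fineP L m) c₀ W),
      γ * ‖x‖ ^ 2 ≤
        RCLike.re ⟪x, laplaceALatticeK ((η : ℂ))⁻¹ (adTransportW φ (fun _ : Bond d (fineP L m) => (1 : 𝔸ˣ)))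
          (adTransportW φ fun _ : Bond d (fineP L m) => (1 : 𝔸ˣ)⁻¹) (principalOpK φ η fun _ => 1) (RofU L m φ η fun _ => 1)
          (QtorusW L m hL φ (fun _ => 1) (show (0 : ℝ) ≤ 1 / 64 by norm_num) (hU1_one L m) (hreg_one L m) (c₁ := c₁)) a x⟫_ℂ := by
  have hC : (1 : ℝ) ≤ B5Prop11Plancherel.Cst d 1 := B5Prop11Lower.one_le_Cst _
  refine ⟨(1 / ((d + 1 : ℝ) * B5Prop11Plancherel.Cst d 1)) * min a 1, ?_, fun L _ hL η hηL0 hηL1 c₀ c₁ _ _ hs m _ x => ?_⟩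
  · have hmin : 0 < min a 1 := lt_min ha one_pos
    positivity
  · exact flat_coercive_canonical L m hL φ (c₁ := c₁) _ (hU1_one L m) (hreg_one L m) ha hηL0 hηL1 hs x

end CanonicalExists

/-! ## §6 The near-flat shape with the linear ∕ spacing-uniform constant (the shape (C2)∕(C2′) consume) -/

section NearFlat

variable (L : ℕ) [NeZero L] (m : Fin d → ℕ) [∀ i, NeZero (fineP L m i)] (hL : 1 ≤ L) {c₀ c₁ : ℝ} [Fact (0 < c₀)] [Fact (0 < c₁)]
  {𝔸 : Type*} [NormedRing 𝔸] [NormedAlgebra ℂ 𝔸] [CompleteSpace 𝔸] [NormOneClass 𝔸]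
  {W : Type*} [NormedAddCommGroup W] [InnerProductSpace ℂ W] [FiniteDimensional ℂ W] (φ : W ≃ₗ[ℂ] 𝔸)
  {η : ℝ} (hη : η ≠ 0) {a : ℝ} (ha : 0 < a)

include hη ha

/-- **[B9] THM 3.11's SECOND HALF NEAR THE FLAT BACKGROUND, WITH THE LINEAR CONSTANT**: whenever `‖(Δ_prin(U) − Δ_prin(1))x‖ ≤ δ‖x‖`,
`(γ(d,1)·min(a″,1)∕(ηL)² − δ)·‖x‖² ≤ re⟨x, Δ_prin(U)x⟩` (`B5Eq172HodgePositivity.coercive_of_sub_le` on §3) — the shape of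
`B5Eq190FlatCoercivityUniform.coercive_principal_of_near_flat_uniform`, the closeness `δ` DISPLAYED as there.
[cite: Balaban1985BackgroundPropagators, Thm 3.11 p.416, (3.86) p.407; Balaban1984PropagatorsI, Prop. 1.1 (1.90) p.33; Balaban1983RegularityDecay, (2.27) p.580] -/
theorem coercive_principal_of_near_flat_spacing_uniform (δ : ℝ) (U : Bond d (fineP L m) → 𝔸ˣ) {αU : ℝ} (hαU : αU ≤ 1 / 64)
    (hU1U : ∀ (x : B7Prop1Explicit.Site d) (κ : Fin d), perCfg (fineP L m) U x κ ∈ U1 𝔸)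
    (hregU : ∀ (y : TSite d m) (κ : Fin d) (r : Fin d → Fin L), ‖((Wcx L (perCfg (fineP L m) U) (cornerSite L y) κ (boxVec L r) : 𝔸ˣ) : 𝔸) - 1‖ ≤ αU)
    (hnear : ∀ x : BondL2K ℂ d (fineP L m) c₀ W,
      ‖laplaceALatticeK ((η : ℂ))⁻¹ (adTransportW φ U) (adTransportW φ fun b => (U b)⁻¹) (principalOpK φ η U) (RofU L m φ η U)
          (QtorusW L m hL φ U hαU hU1U hregU (c₁ := c₁)) a x -
        laplaceALatticeK ((η : ℂ))⁻¹ (adTransportW φ (fun _ : Bond d (fineP L m) => (1 : 𝔸ˣ)))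
          (adTransportW φ fun _ : Bond d (fineP L m) => (1 : 𝔸ˣ)⁻¹) (principalOpK φ η fun _ => 1) (RofU L m φ η fun _ => 1)
          (QtorusW L m hL φ (fun _ => 1) (show (0 : ℝ) ≤ 1 / 64 by norm_num) (hU1_one L m) (hreg_one L m) (c₁ := c₁)) a x‖ ≤ δ * ‖x‖)
    (x : BondL2K ℂ d (fineP L m) c₀ W) :
    ((1 / ((d + 1 : ℝ) * B5Prop11Plancherel.Cst d 1)) * min (a * c₁ * (η * L) ^ 2 / (c₀ * (L : ℝ) ^ d)) 1 * ((η * L)⁻¹) ^ 2 - δ) * ‖x‖ ^ 2 ≤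
      RCLike.re ⟪x, laplaceALatticeK ((η : ℂ))⁻¹ (adTransportW φ U) (adTransportW φ fun b => (U b)⁻¹) (principalOpK φ η U) (RofU L m φ η U)
        (QtorusW L m hL φ U hαU hU1U hregU (c₁ := c₁)) a x⟫_ℂ :=
  coercive_of_sub_le (flat_coercive_uniform_linear L m hL φ (c₁ := c₁) (show (0 : ℝ) ≤ 1 / 64 by norm_num) (hU1_one L m) (hreg_one L m) hη ha) hnear x

omit hη in
/-- **… AND WITH THE SPACING-UNIFORM CONSTANT** (the (C2)∕(C2′)-consumable η-free near-flat face; reader ne9-leaf-02 g59's J13): for `0 < η`,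
`η·L ≤ 1`, whenever `‖(Δ_prin(U) − Δ_prin(1))x‖ ≤ δ‖x‖`, `(γ(d,1)·min(a·c₁∕(c₀L^d), 1) − δ)·‖x‖² ≤ re⟨x, Δ_prin(U)x⟩` — NO `η` in the constant
(`coercive_of_sub_le` on §4). [cite: Balaban1985BackgroundPropagators, Thm 3.11 p.416, (3.86) p.407; Balaban1984PropagatorsI, Prop. 1.1 (1.90) p.33; Balaban1983RegularityDecay, (2.27) p.580] -/
theorem coercive_principal_of_near_flat_eta_free (hη0 : 0 < η) (hηL1 : η * L ≤ 1) (δ : ℝ) (U : Bond d (fineP L m) → 𝔸ˣ) {αU : ℝ}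
    (hαU : αU ≤ 1 / 64) (hU1U : ∀ (x : B7Prop1Explicit.Site d) (κ : Fin d), perCfg (fineP L m) U x κ ∈ U1 𝔸)
    (hregU : ∀ (y : TSite d m) (κ : Fin d) (r : Fin d → Fin L), ‖((Wcx L (perCfg (fineP L m) U) (cornerSite L y) κ (boxVec L r) : 𝔸ˣ) : 𝔸) - 1‖ ≤ αU)
    (hnear : ∀ x : BondL2K ℂ d (fineP L m) c₀ W,
      ‖laplaceALatticeK ((η : ℂ))⁻¹ (adTransportW φ U) (adTransportW φ fun b => (U b)⁻¹) (principalOpK φ η U) (RofU L m φ η U)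
          (QtorusW L m hL φ U hαU hU1U hregU (c₁ := c₁)) a x -
        laplaceALatticeK ((η : ℂ))⁻¹ (adTransportW φ (fun _ : Bond d (fineP L m) => (1 : 𝔸ˣ)))
          (adTransportW φ fun _ : Bond d (fineP L m) => (1 : 𝔸ˣ)⁻¹) (principalOpK φ η fun _ => 1) (RofU L m φ η fun _ => 1)
          (QtorusW L m hL φ (fun _ => 1) (show (0 : ℝ) ≤ 1 / 64 by norm_num) (hU1_one L m) (hreg_one L m) (c₁ := c₁)) a x‖ ≤ δ * ‖x‖)
    (x : BondL2K ℂ d (fineP L m) c₀ W) :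
    ((1 / ((d + 1 : ℝ) * B5Prop11Plancherel.Cst d 1)) * min (a * c₁ / (c₀ * (L : ℝ) ^ d)) 1 - δ) * ‖x‖ ^ 2 ≤
      RCLike.re ⟪x, laplaceALatticeK ((η : ℂ))⁻¹ (adTransportW φ U) (adTransportW φ fun b => (U b)⁻¹) (principalOpK φ η U) (RofU L m φ η U)
        (QtorusW L m hL φ U hαU hU1U hregU (c₁ := c₁)) a x⟫_ℂ :=
  coercive_of_sub_le (flat_coercive_spacing_uniform L m hL φ (c₁ := c₁) (show (0 : ℝ) ≤ 1 / 64 by norm_num) (hU1_one L m) (hreg_one L m) ha hη0 hηL1)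
    hnear x

end NearFlat

end Literature.MathematicalPhysics.QuantumFieldTheory.Balaban1983to89.B5Eq190FlatCoercivitySpacingUniform

end
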